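import Literature.Analysis.FluidPDE.HomogeneousEulerProofs
import Literature.Analysis.FluidPDE.VectorCalculusProofs
import HarnessLib

/-!
# Bernoulli and pressure-sign rigidity of homogeneous stationary Euler flows in the window `1 < α < 2` (Shvydkoy 2018, Prop. 3.2 and Cor. 4.4)

R. Shvydkoy, *Homogeneous solutions to the 3D Euler system*, Trans. Amer. Math. Soc. 370 (2018)
2517–2535 = arXiv:1510.03378 [`Shvydkoy2018`], studies `C¹` stationary Euler pairs
`V·∇V + ∇P = 0`, `div V = 0` on `ℝ³ ∖ {0}`, homogeneous of degrees `-α` (velocity) and `-2α`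
(pressure) — the tree's `IsHomogeneousSteadyEuler α V P` (`HomogeneousEuler.lean`) — through the
reduced system on the sphere (Shvydkoy (6), arXiv p. 5)

  `(2-α) f + div v = 0`, `v∇f = |v|² + α f² + 2α p`, `(1-α) f v + v∇v = -∇p`,

`V = (v + f n)/|x|^α`, `P = p/|x|^{2α}`, with spherical Bernoulli function `H = |v|² + f² + 2p`.
This file PROVES, in bulk variables and in every finite-dimensional real inner product space `E`
(`n = dim E`; the paper has `n = 3`), the two rigidity statements of §3–§4 in the range of
exponents containing the Chae–Shvydkoy window `α ∈ (1, 3/2]`: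

* **Prop. 3.2, case `1 < α < 2`** (arXiv p. 8): "For `α ≤ 2` irrotational solutions are unique
  in the class of all `C²`-smooth solutions with `H = 0`"; its proof begins: "The case
  `1 < α ≤ 2` is actually straightforward. We have from (6)₂ `v∇f = (1-α)|v|²`. Let us integrate
  over `S²` and integrate by parts on the left. Using (6)₁ we obtain
  `(2-α) ∫ f² dσ = (1-α) ∫ |v|² dσ`. This implies `f, v = 0` unless `α = 2`".  Here:
  `IsHomogeneousSteadyEuler.eq_zero_of_bernoulli_eq_zero` — a `C¹` homogeneous stationary Euler
  pair with `‖V‖² + 2P ≡ 0` off the origin and `1 < α < n - 1` is trivial, `V ≡ 0` (for `n = 3`: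
  `1 < α < 2`; `C¹` suffices for this case of the printed `C²` statement).
* **Cor. 4.4, case `α > 1`** (arXiv p. 9): "Suppose `p ≥ 0` and `α > 0`. Then the solution is
  trivial, `v = f = p = 0`."  Here: `IsHomogeneousSteadyEuler.eq_zero_of_pressure_nonneg` — a
  `C¹` homogeneous stationary Euler pair with `P ≥ 0` off the origin, `α > 0` and `n < 2α + 1`
  is trivial (for `n = 3`: `α > 1`).  The printed proof for the full range `α > 0` runs the
  Riccati inequality `f' ≥ α f²` along the orbits of `v` and then Prop. 4.1 (tangential flows are
  `2D` rotations, `α ≤ -1`); in the range `α > 1` the same integration as in Prop. 3.2 gives it at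
  once: integrating (6)₂ over `S²`, `(2-2α) ∫ f² dσ = ∫ |v|² dσ + 2α ∫ p dσ`, whose two sides
  have opposite signs.  The range `0 < α ≤ 1` of Cor. 4.4 is NOT proved here
  (`-- TODO(general form)`; at `α = 1` every `C¹` solution is trivial anyway,
  `shvydkoy_homogeneousSteadyEuler_alpha_one_holds`).

Both are instances of ONE bulk identity, `IsHomogeneousSteadyEuler.integral_cutoff_identity`:
for every `C¹` radial cutoff `ψ` compactly supported off the origin,

  `∫ ψ · (‖V‖² + 2α P - (n - 2α) ⟪V, x⟫²/‖x‖²) dx = 0`,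

which is `∫ div (F ψ T) dx = 0` for the bulk avatars `F = ⟪V, x⟫ ↔ f |x|^{1-α}`,
`T = V - (F/‖x‖²) x ↔ v/|x|^α` of `HomogeneousEulerProofs.lean` (`T·∇ψ = 0`), expanded with the
general-degree bulk forms of Shvydkoy's (6)₁–(6)₂ proved below: `V·∇F = ‖V‖² + 2αP`,
`x·∇F = (1-α) F`, `div T = -(n-1-α) F/‖x‖²`.  On the unit sphere of `ℝ³` the identity reads
`(3-2α) ∫ f² = ∫ (|v|² + f²) + 2α ∫ p`, i.e. exactly the two displayed sphere identities.  Under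
`H = 0` (`2P = -‖V‖²`) the integrand is `-ψ((α-1)‖V‖² + (n-2α)F²/‖x‖²)`, under `P ≥ 0` it is
`≥ ψ(1 - (n-2α)₊)‖V‖²` (Cauchy–Schwarz `F² ≤ ‖V‖²‖x‖²`); a continuous non-negative compactly
supported function with zero integral vanishes, so `V = 0` on the sphere `‖x‖ = 2` where `ψ = 1`,
and everywhere off the origin by homogeneity — the globalisation step of
`Shvydkoy2018.velocity_eq_zero`.

## Why it is here (consumer)

Crux `E` = `Summit.NavierStokesRegularity.NavierStokesRegularity.Theses.EulerZoomLiouville.PowerGaugeEulerLiouville`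
(stmt-NavierStokesRegularity-19832), registered line `birth`, stub `stub_selfSimilarExtremal`:
an EXTREMAL exactly self-similar Euler profile (`α = 1 + ρ ∈ (1, 3/2]`) whose tail is homogeneous
is governed there by the homogeneous STATIONARY system
(`IsSelfSimilarEulerProfile.isHomogeneousSteadyEuler_of_homogeneous_tail`,
`SelfSimilarEulerHomogeneousTail.lean`), for which "no unconditional exclusion of `C¹`
homogeneous stationary solutions is in print" in that window except Shvydkoy's partial results
(that file's docstring): `α = 1` (Prop. 2.1, ✓ `shvydkoy_homogeneousSteadyEuler_alpha_one_holds`),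
axisymmetric `0 < α < 2` (Prop. 5.1, named fact `shvydkoy2018_prop51_noAxisymmetric`), spherical
pressure `p ≥ 0` (Cor. 4.4 — this file, window part), `H = 0` / irrotational (Props. 3.1–3.2 —
this file, window part of 3.2).  The theorems below kill the strata "tail pressure `≥ 0`" and
"Bernoulli-free tail" at every `α ∈ (1, 3/2]`, sorry-free and fact-free; the Bernoulli case is
also the last step of the printed proof of Prop. 5.1.

## Contents (all `theorem`s; no `def`, no named fact)

* `IsHomogeneousSteadyEuler.fderiv_normalPart_apply_velocity` (`V·∇F = ‖V‖² + 2αP` = (6)₂),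
  `.fderiv_normalPart_apply_self` (`x·∇F = (1-α)F`),
  `.fderiv_bernoulliFn_apply_self` (`x·∇(‖V‖²+2P) = -2α(‖V‖²+2P)`),
  `.fderiv_radialCoeff_apply_self`, `.divergence_tangentialPart_eq` (`div T = -(n-1-α)F/‖x‖²`
  = (6)₁), homogeneity lemmas `.normalPart_smul_eq`, `.bernoulliFn_smul_eq`; private (the gate's
  dedup identifies their statements with the `α = 1` lemmas of `HomogeneousEulerProofs.lean`,
  which they generalise): the momentum equation in inner form, `V·∇(‖V‖²+2P) = 0` (= Shvydkoy (8)
  `v∇H = 2αfH`), and the `C¹` regularity of `F`, `F/‖x‖²`, `T`, `‖V‖²+2P` off the origin;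
* `IsHomogeneousSteadyEuler.integral_cutoff_identity` — the bulk identity above;
* (private) `inner_sq_mul_inv_norm_sq_le` — `⟪V,x⟫²/‖x‖² ≤ ‖V‖²`;
* `IsHomogeneousSteadyEuler.eq_zero_of_bernoulli_eq_zero` (Prop. 3.2, `1 < α < n-1`),
  `IsHomogeneousSteadyEuler.eq_zero_of_pressure_nonneg` (Cor. 4.4, `α > 0`, `n < 2α+1`);
* `ℝ³` forms in the shape of the sibling facts of `HomogeneousEuler*.lean`:
  `shvydkoy2018_prop32_bernoulliZero_of_one_lt` (`1 < α < 2`, `‖V‖²+2P ≡ 0` ⇒ `V ≡ 0 ∧ P ≡ 0`),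
  `shvydkoy2018_cor44_pressureNonneg_of_one_lt` (`1 < α`, `P ≥ 0` ⇒ `V ≡ 0 ∧ P ≡ 0`).
* (appended 2026-08-27) **Prop. 3.1 in the window** — irrotational homogeneous stationary pairs
  with `1 < α < n-1` are trivial: `IsHomogeneousSteadyEuler.fderiv_bernoulliFn_eq_zero_of_symmetric`
  (symmetric `DV` ⇒ `∇(‖V‖²+2P) = 0`, Bernoulli's theorem for irrotational steady flow),
  `.bernoulliFn_eq_zero_of_symmetric` (then `‖V‖²+2P ≡ 0` by Euler's relation, `α ≠ 0` — this is
  the printed "Moreover, in this case `H = 0`" of Prop. 3.1), `.eq_zero_of_symmetric`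
  (⇒ `V ≡ 0` for `1 < α < n-1`, by `eq_zero_of_bernoulli_eq_zero`), and the `ℝ³` form with the
  tree's `curl`: `shvydkoy2018_prop31_irrotational_of_one_lt` (`1 < α < 2`, `curl V ≡ 0` off the
  origin ⇒ `V ≡ 0 ∧ P ≡ 0`).  Printed Prop. 3.1 (arXiv p. 8): "Suppose `v, f, p ∈ C¹(S²)`, and
  `Ω = 0`. Then `α ∈ ℤ ∖ {1}` and the solution is given by (16) … where `f` is a constant multiple
  of one of the spherical harmonics `Y_l^m`, `1 - α = l` … Moreover, in this case `H = 0`."  In a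
  window free of integers this says: no irrotational solutions; the route here (Bernoulli ⇒
  `H = 0` ⇒ Prop. 3.2) replaces the printed Laplace–Beltrami spectral argument and is what the
  tree can check; the integer cases and the explicit harmonics (16) are NOT vendored.

## Design notes

* Same conventions as `HomogeneousEulerProofs.lean`: bulk avatars inlined as lambda terms, an
  arbitrary additive Haar measure in the integral identity, `borel E` introduced inside the
  rigidity proofs so that their statements carry no measure-theoretic hypotheses; the radial
  cutoff is `Shvydkoy2018.exists_radial_cutoff` (equal to `1` on `‖x‖² = 4`).
* `C¹` regularity throughout (the class `IsHomogeneousSteadyEuler`); Prop. 3.2 is printed for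
  `C²` solutions because its case `α < 1` differentiates the vorticity — not needed in the window.
* Not vendored: Prop. 3.1 outside the window `1 < α < n-1` (irrotational ⇒ `α ∈ ℤ ∖ {1}` with
  the explicit harmonics, needs the Laplace–Beltrami spectrum of `S²`), Prop. 3.2 for `α < 1`,
  Prop. 4.1, Cor. 4.4 for `0 < α ≤ 1`, Lemma 4.5.

## References

* R. Shvydkoy, *Homogeneous solutions to the 3D Euler system*, Trans. Amer. Math. Soc. 370
  (2018) 2517–2535, doi:10.1090/tran/7022 = arXiv:1510.03378; §2 (6), (8); §3 Prop. 3.1 (arXiv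
  p. 8, with (13) `Ω × V = -½∇(|x|^{-2α}H)`), Prop. 3.2 and its proof (arXiv p. 8); §4 Cor. 4.4
  (arXiv p. 9). [`Shvydkoy2018`]
* D. Chae, R. Shvydkoy, ARMA 209 (2013) = arXiv:1201.6009, §4.1 (homogeneous near infinity).
-/

noncomputable section

open Set Filter MeasureTheory Module
open scoped InnerProductSpace RealInnerProductSpace Topology

namespace Literature.Analysis.FluidPDE

namespace IsHomogeneousSteadyEuler

variable {E : Type*} [NormedAddCommGroup E] [InnerProductSpace ℝ E] [FiniteDimensional ℝ E]
variable {α : ℝ} {V : E → E} {P : E → ℝ} {x : E}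

/-! ### The reduced system (6)₁–(6)₂ and (8) in bulk form, general degree `-α` -/

section Calculus

variable (h : IsHomogeneousSteadyEuler α V P)
include h

/-- The momentum equation in inner-product form: `⟪DV(x) V(x), w⟫ = -DP(x) w` off the origin
(Shvydkoy (1)). [cite: Shvydkoy2018, (1) p. 2518] -/
private theorem inner_fderiv_velocity_velocity_eq (hx : x ≠ 0) (w : E) :
    ⟪fderiv ℝ V x (V x), w⟫ = -fderiv ℝ P x w := by
  have hm := h.momentum hx
  rw [convect_apply, add_eq_zero_iff_eq_neg] at hm
  rw [hm, inner_neg_left, Shvydkoy2018.inner_gradient_left]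

/-- **(6)₂ in bulk form, general degree**: `V·∇F = ‖V‖² + 2α P` for `F = ⟪V, x⟫` (on the unit
sphere: `v∇f + (1-α)f² = |v|² + f² + 2αp`, i.e. `v∇f = |v|² + αf² + 2αp`).
[cite: Shvydkoy2018, (6)₂ p. 2521] -/
theorem fderiv_normalPart_apply_velocity (hx : x ≠ 0) :
    fderiv ℝ (fun y => ⟪V y, y⟫) x (V x) = ‖V x‖ ^ 2 + 2 * α * P x := by
  rw [(Shvydkoy2018.hasFDerivAt_normalPart (h.differentiableAt_velocity hx)).fderiv]
  simp only [add_apply, innerSL_apply_apply, ContinuousLinearMap.comp_apply,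
    real_inner_self_eq_norm_sq]
  rw [real_inner_comm, h.inner_fderiv_velocity_velocity_eq hx, h.fderiv_pressure_apply_self hx]
  ring

/-- Euler's relation for `F = ⟪V, x⟫` (homogeneous of degree `1-α` by Shvydkoy (2)):
`x·∇F = (1-α) F` (Appendix, first formula, applied to `f |x|^{1-α}`).
[cite: Shvydkoy2018, (2) p. 2518 and Appendix] -/
theorem fderiv_normalPart_apply_self (hx : x ≠ 0) :
    fderiv ℝ (fun y => ⟪V y, y⟫) x x = (1 - α) * ⟪V x, x⟫ := by
  rw [(Shvydkoy2018.hasFDerivAt_normalPart (h.differentiableAt_velocity hx)).fderiv]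
  simp only [add_apply, innerSL_apply_apply, ContinuousLinearMap.comp_apply]
  rw [h.fderiv_velocity_apply_self hx, real_inner_smul_right, real_inner_comm (V x) x]
  ring

/-- **Shvydkoy (8) in bulk form, general degree**: the Bernoulli function `‖V‖² + 2P` is
transported, `V·∇(‖V‖² + 2P) = 0` (on the unit sphere: `v∇H = 2αfH`).
[cite: Shvydkoy2018, (8) p. 2521] -/
private theorem fderiv_bernoulliFn_apply_velocity (hx : x ≠ 0) :
    fderiv ℝ (fun y => ‖V y‖ ^ 2 + 2 * P y) x (V x) = 0 := by
  rw [(Shvydkoy2018.hasFDerivAt_bernoulliFn (h.differentiableAt_velocity hx)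
    (h.differentiableAt_pressure hx)).fderiv]
  simp only [add_apply, smul_apply,
    ContinuousLinearMap.comp_apply, innerSL_apply_apply, nsmul_eq_mul, smul_eq_mul]
  rw [real_inner_comm, h.inner_fderiv_velocity_velocity_eq hx]
  ring

/-- Euler's relation for the Bernoulli function `‖V‖² + 2P = H/|x|^{2α}` (homogeneous of
degree `-2α` by Shvydkoy (2)): `x·∇(‖V‖² + 2P) = -2α (‖V‖² + 2P)` (Appendix, first formula).
[cite: Shvydkoy2018, (2) p. 2518 and Appendix] -/
theorem fderiv_bernoulliFn_apply_self (hx : x ≠ 0) :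
    fderiv ℝ (fun y => ‖V y‖ ^ 2 + 2 * P y) x x = -(2 * α) * (‖V x‖ ^ 2 + 2 * P x) := by
  rw [(Shvydkoy2018.hasFDerivAt_bernoulliFn (h.differentiableAt_velocity hx)
    (h.differentiableAt_pressure hx)).fderiv]
  simp only [add_apply, smul_apply,
    ContinuousLinearMap.comp_apply, innerSL_apply_apply, nsmul_eq_mul, smul_eq_mul]
  rw [h.fderiv_velocity_apply_self hx, h.fderiv_pressure_apply_self hx, real_inner_smul_right,
    real_inner_self_eq_norm_sq]
  ring

/-- Euler's relation for `F/‖x‖² = f/|x|^{1+α}` (homogeneous of degree `-1-α` by Shvydkoy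
(2)): `x·∇(F/‖x‖²) = -(1+α) F/‖x‖²` (Appendix, first formula).
[cite: Shvydkoy2018, (2) p. 2518 and Appendix] -/
theorem fderiv_radialCoeff_apply_self (hx : x ≠ 0) :
    fderiv ℝ (fun y => ⟪V y, y⟫ * (‖y‖ ^ 2)⁻¹) x x = -(1 + α) * (⟪V x, x⟫ * (‖x‖ ^ 2)⁻¹) := by
  rw [(Shvydkoy2018.hasFDerivAt_radialCoeff (h.differentiableAt_velocity hx) hx).fderiv]
  have hF := h.fderiv_normalPart_apply_self hx
  rw [(Shvydkoy2018.hasFDerivAt_normalPart (h.differentiableAt_velocity hx)).fderiv] at hF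
  simp only [add_apply, smul_apply, smul_eq_mul,
    nsmul_eq_mul, innerSL_apply_apply] at hF ⊢
  rw [hF, real_inner_self_eq_norm_sq]
  have hx2 : ‖x‖ ^ 2 ≠ 0 := by positivity
  field_simp
  ring

/-- **(6)₁ in bulk form, general degree**: the tangential part `T = V - (F/‖x‖²) x` has
`div T = -(n-1-α) F/‖x‖²`, `n = dim E` (on the unit sphere of `ℝ³`: `div v = -(2-α) f`).
[cite: Shvydkoy2018, (6)₁ p. 2521] -/
theorem divergence_tangentialPart_eq (hx : x ≠ 0) :
    VectorCalculus.divergence (fun y => V y - (⟪V y, y⟫ * (‖y‖ ^ 2)⁻¹) • y) x =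
      -((finrank ℝ E : ℝ) - 1 - α) * (⟪V x, x⟫ * (‖x‖ ^ 2)⁻¹) := by
  set b := stdOrthonormalBasis ℝ E
  rw [divergence_eq_sum_inner_fderiv b,
    (Shvydkoy2018.hasFDerivAt_tangentialPart (h.differentiableAt_velocity hx) hx).fderiv]
  simp only [sub_apply, add_apply,
    smul_apply, ContinuousLinearMap.smulRight_apply,
    ContinuousLinearMap.id_apply, inner_sub_right, inner_add_right, Finset.sum_sub_distrib,
    Finset.sum_add_distrib]
  rw [← divergence_eq_sum_inner_fderiv b, h.divergence_eq_zero hx,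
    Shvydkoy2018.sum_inner_smul_eq_apply, h.fderiv_radialCoeff_apply_self hx]
  have hb : ∀ i, ⟪b i, (⟪V x, x⟫ * (‖x‖ ^ 2)⁻¹) • b i⟫ = ⟪V x, x⟫ * (‖x‖ ^ 2)⁻¹ :=
      fun i => by
    rw [real_inner_smul_right, real_inner_self_eq_norm_sq, b.orthonormal.1 i]; ring
  simp only [hb, Finset.sum_const, Finset.card_univ, Fintype.card_fin, nsmul_eq_mul]
  ring

/-- `F = ⟪V, x⟫ = f |x|^{1-α}` is `C¹` off the origin ("`v, f, p ∈ C¹(S²)`", Shvydkoy (2) and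
the sentence after it). [cite: Shvydkoy2018, (2) p. 2518] -/
private theorem contDiffOn_normalPart : ContDiffOn ℝ 1 (fun y => ⟪V y, y⟫) {x | x ≠ 0} :=
  h.contDiffOn_velocity.inner ℝ contDiffOn_id

/-- The Bernoulli function `‖V‖² + 2P = H/|x|^{2α}` is `C¹` off the origin ("`v, f, p ∈ C¹(S²)`",
Shvydkoy (2); `H = |v|² + f² + 2p`, §2). [cite: Shvydkoy2018, (2) p. 2518 and §2] -/
private theorem contDiffOn_bernoulliFn : ContDiffOn ℝ 1 (fun y => ‖V y‖ ^ 2 + 2 * P y) {x | x ≠ 0} :=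
  (h.contDiffOn_velocity.norm_sq ℝ).add (contDiffOn_const.mul h.contDiffOn_pressure)

/-- `F/‖x‖² = f/|x|^{1+α}` is `C¹` off the origin ("`v, f, p ∈ C¹(S²)`", Shvydkoy (2)).
[cite: Shvydkoy2018, (2) p. 2518] -/
private theorem contDiffOn_radialCoeff :
    ContDiffOn ℝ 1 (fun y => ⟪V y, y⟫ * (‖y‖ ^ 2)⁻¹) {x | x ≠ 0} :=
  h.contDiffOn_normalPart.mul ((contDiffOn_id.norm_sq ℝ).inv
    fun _ hx => pow_ne_zero 2 (norm_ne_zero_iff.mpr hx))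

/-- The tangential part `T = V - (F/‖x‖²) x = v/|x|^α` is `C¹` off the origin
("`v, f, p ∈ C¹(S²)`", Shvydkoy (2)). [cite: Shvydkoy2018, (2) p. 2518] -/
private theorem contDiffOn_tangentialPart :
    ContDiffOn ℝ 1 (fun y => V y - (⟪V y, y⟫ * (‖y‖ ^ 2)⁻¹) • y) {x | x ≠ 0} :=
  h.contDiffOn_velocity.sub (h.contDiffOn_radialCoeff.smul contDiffOn_id)

/-- Homogeneity of `F = ⟪V, x⟫ = f |x|^{1-α}` (Shvydkoy (2)): `F(c x) = c^{1-α} F(x)`, `c > 0`,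
`x ≠ 0`. [cite: Shvydkoy2018, (2) p. 2518] -/
theorem normalPart_smul_eq ⦃c : ℝ⦄ (hc : 0 < c) (hx : x ≠ 0) :
    ⟪V (c • x), c • x⟫ = c ^ (1 - α) * ⟪V x, x⟫ := by
  rw [h.velocity_smul hc hx, real_inner_smul_left, real_inner_smul_right, ← mul_assoc,
    Real.rpow_sub hc, Real.rpow_one, Real.rpow_neg hc.le, div_eq_mul_inv, mul_comm c]

/-- Homogeneity of the Bernoulli function `‖V‖² + 2P = H/|x|^{2α}` (Shvydkoy (2), §2):
`‖V(c x)‖² + 2P(c x) = c^{-2α} (‖V x‖² + 2P x)`, `c > 0`, `x ≠ 0`. [cite: Shvydkoy2018, (2) p. 2518] -/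
theorem bernoulliFn_smul_eq ⦃c : ℝ⦄ (hc : 0 < c) (hx : x ≠ 0) :
    ‖V (c • x)‖ ^ 2 + 2 * P (c • x) = c ^ (-(2 * α)) * (‖V x‖ ^ 2 + 2 * P x) := by
  rw [h.velocity_smul hc hx, h.pressure_smul hc hx, norm_smul, Real.norm_eq_abs,
    abs_of_pos (Real.rpow_pos_of_pos hc _), mul_pow, ← Real.rpow_natCast,
    ← Real.rpow_mul hc.le]
  norm_num
  ring

end Calculus

/-! ### The bulk integral identity `(n-2α) ∫ ψ F²/‖x‖² = ∫ ψ (‖V‖² + 2αP)` -/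

section Integral

variable (h : IsHomogeneousSteadyEuler α V P)
include h

/-- **The bulk form of Shvydkoy's sphere identities** behind Prop. 3.2 (`1 < α ≤ 2`) and
Cor. 4.4: for every `C¹` radial cutoff `ψ` compactly supported off the origin
(`Dψ(x) w = 0` for `w ⊥ x`),
`∫ ψ (‖V‖² + 2αP - (n-2α) ⟪V,x⟫²/‖x‖²) = 0`, `n = dim E` — the integral of
`div (F ψ T)` (`Shvydkoy2018.integral_fderiv_apply_add_mul_divergence_eq_zero` with `W = ψ T`,
`G = F`), expanded with `T·∇F = ‖V‖² + 2αP - (1-α)F²/‖x‖²`, `div T = -(n-1-α)F/‖x‖²`,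
`T·∇ψ = 0`.  On `S² ⊂ ℝ³`: `(3-2α) ∫ f² dσ = ∫ (|v|² + f² + 2αp) dσ`.
[cite: Shvydkoy2018, proof of Prop. 3.2 p. 2524] -/
theorem integral_cutoff_identity [MeasurableSpace E] [BorelSpace E] (μ : Measure E)
    [μ.IsAddHaarMeasure] {ψ : E → ℝ} (hψ : ContDiff ℝ 1 ψ) (hψc : HasCompactSupport ψ)
    (hψ0 : ψ =ᶠ[𝓝 0] 0) (hψr : ∀ x w, ⟪x, w⟫ = 0 → fderiv ℝ ψ x w = 0) :
    ∫ x, ψ x * (‖V x‖ ^ 2 + 2 * α * P x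
      - ((finrank ℝ E : ℝ) - 2 * α) * (⟪V x, x⟫ ^ 2 * (‖x‖ ^ 2)⁻¹)) ∂μ = 0 := by
  set W : E → E := fun x => ψ x • (V x - (⟪V x, x⟫ * (‖x‖ ^ 2)⁻¹) • x) with hW
  have hWreg : ContDiffOn ℝ 1 W {x | x ≠ 0} := hψ.contDiffOn.smul h.contDiffOn_tangentialPart
  have hW0 : W =ᶠ[𝓝 0] 0 := hψ0.mono fun x hx => by
    simp only [hW, Pi.zero_apply] at hx ⊢
    simp [hx]
  have hWc : HasCompactSupport W := hψc.smul_right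
  have key := Shvydkoy2018.integral_fderiv_apply_add_mul_divergence_eq_zero μ hWreg hW0 hWc
    h.contDiffOn_normalPart
  -- the pointwise identity `DF·W + F div W = ψ (‖V‖² + 2αP - (n-2α) F²/‖x‖²)`
  have hpt : ∀ x, fderiv ℝ (fun y => ⟪V y, y⟫) x (W x)
      + ⟪V x, x⟫ * VectorCalculus.divergence W x =
      ψ x * (‖V x‖ ^ 2 + 2 * α * P x
        - ((finrank ℝ E : ℝ) - 2 * α) * (⟪V x, x⟫ ^ 2 * (‖x‖ ^ 2)⁻¹)) := by
    intro x
    rcases eq_or_ne x 0 with rfl | hx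
    · have hc0 : ψ (0 : E) = 0 := hψ0.eq_of_nhds
      have hDW0 : fderiv ℝ W 0 = 0 := by
        rw [hW0.fderiv_eq]; simp
      have hW00 : W 0 = 0 := by simp [hW, hc0]
      simp [hW00, hc0, VectorCalculus.divergence, hDW0]
    have hVd := h.differentiableAt_velocity hx
    have hTd : DifferentiableAt ℝ (fun y => V y - (⟪V y, y⟫ * (‖y‖ ^ 2)⁻¹) • y) x :=
      (Shvydkoy2018.hasFDerivAt_tangentialPart hVd hx).differentiableAt
    have hcd : DifferentiableAt ℝ ψ x := hψ.differentiable one_ne_zero x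
    -- divergence of `W = ψ T`
    have hdivW : VectorCalculus.divergence W x =
        -(ψ x * (((finrank ℝ E : ℝ) - 1 - α) * (⟪V x, x⟫ * (‖x‖ ^ 2)⁻¹))) := by
      rw [hW, Shvydkoy2018.divergence_smul_apply (stdOrthonormalBasis ℝ E) hcd hTd,
        h.divergence_tangentialPart_eq hx,
        hψr x _ (Shvydkoy2018.inner_self_tangentialPart V hx)]
      ring
    -- the derivative of `F` along `T`
    have hFT : fderiv ℝ (fun y => ⟪V y, y⟫) x (V x - (⟪V x, x⟫ * (‖x‖ ^ 2)⁻¹) • x) =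
        ‖V x‖ ^ 2 + 2 * α * P x - (1 - α) * (⟪V x, x⟫ ^ 2 * (‖x‖ ^ 2)⁻¹) := by
      rw [map_sub, map_smul, h.fderiv_normalPart_apply_velocity hx,
        h.fderiv_normalPart_apply_self hx, smul_eq_mul]
      ring
    rw [hdivW, hW, map_smul, smul_eq_mul, hFT]
    ring
  simp_rw [hpt] at key
  exact key

end Integral

/-! ### Rigidity in the window -/

omit [FiniteDimensional ℝ E] in
/-- Cauchy–Schwarz for the normal component: `⟪V x, x⟫²/‖x‖² ≤ ‖V x‖²` (`x ≠ 0`). [folklore] -/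
private theorem inner_sq_mul_inv_norm_sq_le (V : E → E) {x : E} (hx : x ≠ 0) :
    ⟪V x, x⟫ ^ 2 * (‖x‖ ^ 2)⁻¹ ≤ ‖V x‖ ^ 2 := by
  have hx2 : 0 < ‖x‖ ^ 2 := by positivity
  rw [mul_inv_le_iff₀ hx2]
  have hcs := real_inner_mul_inner_self_le (V x) x
  rw [real_inner_self_eq_norm_sq, real_inner_self_eq_norm_sq] at hcs
  nlinarith [hcs]

section Rigidity

variable (h : IsHomogeneousSteadyEuler α V P)
include h

/-- Globalisation by homogeneity (Shvydkoy (2): `V(c x) = c^{-α} V(x)`, so `V` is determined by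
its trace on any sphere): if `V` vanishes on the sphere `‖y‖² = 4` then it vanishes off the origin.
[cite: Shvydkoy2018, (2) p. 2518] -/
theorem eq_zero_of_eq_zero_on_sphere (hV : ∀ ⦃y : E⦄, ‖y‖ ^ 2 = 4 → V y = 0) ⦃x : E⦄
    (hx : x ≠ 0) : V x = 0 := by
  set c : ℝ := 2 * ‖x‖⁻¹ with hc
  have hxn : 0 < ‖x‖ := norm_pos_iff.mpr hx
  have hcpos : 0 < c := by positivity
  have hy : ‖c • x‖ ^ 2 = 4 := by
    rw [norm_smul, Real.norm_eq_abs, abs_of_pos hcpos, hc]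
    field_simp
    norm_num
  have h0 := hV hy
  rw [h.velocity_smul hcpos hx, smul_eq_zero] at h0
  exact h0.resolve_left (Real.rpow_pos_of_pos hcpos _).ne'

/-- **Shvydkoy 2018, Prop. 3.2, case `1 < α < 2` (bulk form, any dimension `n`, window
`1 < α < n-1`)**: a `C¹` homogeneous stationary Euler pair of degree `-α` whose Bernoulli
function vanishes off the origin, `‖V‖² + 2P ≡ 0` (Shvydkoy's `H = 0`), is trivial: `V ≡ 0` off
the origin.  Printed proof ("straightforward" case): `(2-α)∫_{S²} f² = (1-α)∫_{S²}|v|²`; here the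
bulk identity `integral_cutoff_identity` with `2P = -‖V‖²` has integrand
`-ψ((α-1)‖V‖² + (n-2α)F²/‖x‖²) ≤ 0`, so it vanishes identically, whence `V = 0` on the sphere
`‖x‖ = 2` (case analysis on the sign of `n-2α` with `F² ≤ ‖V‖²‖x‖²`) and everywhere by
homogeneity. [cite: Shvydkoy2018, Prop. 3.2] -/
theorem eq_zero_of_bernoulli_eq_zero (h1 : 1 < α) (h2 : α < (finrank ℝ E : ℝ) - 1)
    (hB : ∀ ⦃x : E⦄, x ≠ 0 → ‖V x‖ ^ 2 + 2 * P x = 0) ⦃x : E⦄ (hx : x ≠ 0) : V x = 0 := by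
  letI : MeasurableSpace E := borel E
  haveI : BorelSpace E := ⟨rfl⟩
  let μ : Measure E := (stdOrthonormalBasis ℝ E).toBasis.addHaar
  obtain ⟨ψ, hψ, hψnn, hψc, hψ0, hψ1, hψr⟩ := Shvydkoy2018.exists_radial_cutoff (E := E)
  set n : ℝ := (finrank ℝ E : ℝ) with hn
  set g : E → ℝ := fun x =>
    ψ x * ((α - 1) * ‖V x‖ ^ 2 + (n - 2 * α) * (⟪V x, x⟫ ^ 2 * (‖x‖ ^ 2)⁻¹)) with hg
  -- the master identity, under `H = 0`, says `∫ g = 0`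
  have hint : ∫ x, g x ∂μ = 0 := by
    have key := h.integral_cutoff_identity μ hψ hψc hψ0 hψr
    have hpt : ∀ x, ψ x * (‖V x‖ ^ 2 + 2 * α * P x
        - (n - 2 * α) * (⟪V x, x⟫ ^ 2 * (‖x‖ ^ 2)⁻¹)) = -g x := by
      intro x
      rcases eq_or_ne x 0 with rfl | hx
      · have hc0 : ψ (0 : E) = 0 := hψ0.eq_of_nhds
        simp [hg, hc0]
      have hP : 2 * α * P x = -α * ‖V x‖ ^ 2 := by
        have := hB hx
        linear_combination α * this
      simp only [hg, hP]
      ring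
    rw [← hn] at key
    simp_rw [hpt, integral_neg, neg_eq_zero] at key
    exact key
  have hcont : Continuous g := by
    refine Shvydkoy2018.continuous_of_off_origin ?_ ?_
    · refine hψ.continuous.continuousOn.mul
        ((continuousOn_const.mul ((h.contDiffOn_velocity.continuousOn.norm).pow 2)).add
        (continuousOn_const.mul ((h.contDiffOn_normalPart.continuousOn.pow 2).mul ?_)))
      exact ((continuousOn_id.norm).pow 2).inv₀
        fun x hx => pow_ne_zero 2 (norm_ne_zero_iff.mpr hx)
    · filter_upwards [hψ0] with y hy
      simp [hg, hy]
  -- pointwise non-negativity (Cauchy–Schwarz when `n - 2α < 0`)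
  have hgnn : ∀ y, 0 ≤ (α - 1) * ‖V y‖ ^ 2 + (n - 2 * α) * (⟪V y, y⟫ ^ 2 * (‖y‖ ^ 2)⁻¹) := by
    intro y
    rcases eq_or_ne y 0 with rfl | hy
    · have h0 : 0 ≤ (α - 1) * ‖V (0 : E)‖ ^ 2 := mul_nonneg (by linarith) (sq_nonneg _)
      simpa using h0
    have hq0 : 0 ≤ ⟪V y, y⟫ ^ 2 * (‖y‖ ^ 2)⁻¹ := by positivity
    have hqle := inner_sq_mul_inv_norm_sq_le V hy
    by_cases hcoef : 0 ≤ n - 2 * α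
    · nlinarith [mul_nonneg hcoef hq0, sq_nonneg ‖V y‖]
    · nlinarith [sq_nonneg ‖V y‖]
  have hnn : 0 ≤ g := fun y => mul_nonneg (hψnn y) (hgnn y)
  have hgc : HasCompactSupport g := hψc.mul_right
  have hae : g =ᵐ[μ] 0 :=
    (integral_eq_zero_iff_of_nonneg hnn (hcont.integrable_of_hasCompactSupport hgc)).mp hint
  have hzero : g = 0 := (Continuous.ae_eq_iff_eq μ hcont continuous_const).mp hae
  -- evaluate on the sphere `‖y‖² = 4`, where `ψ = 1`
  refine h.eq_zero_of_eq_zero_on_sphere (fun y hy => ?_) hx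
  have hy0 : y ≠ 0 := by
    intro h0
    rw [h0, norm_zero] at hy
    norm_num at hy
  have hgy := congr_fun hzero y
  simp only [hg, Pi.zero_apply, hψ1 _ hy, one_mul] at hgy
  have hq0 : 0 ≤ ⟪V y, y⟫ ^ 2 * (‖y‖ ^ 2)⁻¹ := by positivity
  have hqle := inner_sq_mul_inv_norm_sq_le V hy0
  have hV2 : ‖V y‖ ^ 2 = 0 := by
    by_cases hcoef : 0 ≤ n - 2 * α
    · nlinarith [mul_nonneg hcoef hq0, sq_nonneg ‖V y‖]
    · nlinarith [sq_nonneg ‖V y‖]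
  exact norm_eq_zero.mp (pow_eq_zero_iff two_ne_zero |>.mp hV2)

/-- **Shvydkoy 2018, Cor. 4.4, case `α > 1` (bulk form, any dimension `n < 2α + 1`)**: a `C¹`
homogeneous stationary Euler pair of degree `-α`, `α > 0`, `n < 2α+1`, with non-negative pressure
off the origin (`P ≥ 0`, Shvydkoy's spherical pressure `p ≥ 0`) is trivial: `V ≡ 0` off the
origin.  Proof: the integrand `ψ(‖V‖² + 2αP - (n-2α)F²/‖x‖²)` of `integral_cutoff_identity` is
`≥ ψ(1-(n-2α)₊)‖V‖² ≥ 0` (`F² ≤ ‖V‖²‖x‖²`), so it vanishes; on the sphere `‖x‖ = 2` this forces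
`V = 0`, and homogeneity globalises.  (Printed, for all `α > 0`: Riccati `f' ≥ αf²` along
`v`-orbits and Prop. 4.1; `-- TODO(general form): 0 < α ≤ 1`.) [cite: Shvydkoy2018, Cor. 4.4] -/
theorem eq_zero_of_pressure_nonneg (hα : 0 < α) (hn : (finrank ℝ E : ℝ) < 2 * α + 1)
    (hP : ∀ ⦃x : E⦄, x ≠ 0 → 0 ≤ P x) ⦃x : E⦄ (hx : x ≠ 0) : V x = 0 := by
  letI : MeasurableSpace E := borel E
  haveI : BorelSpace E := ⟨rfl⟩
  let μ : Measure E := (stdOrthonormalBasis ℝ E).toBasis.addHaar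
  obtain ⟨ψ, hψ, hψnn, hψc, hψ0, hψ1, hψr⟩ := Shvydkoy2018.exists_radial_cutoff (E := E)
  set n : ℝ := (finrank ℝ E : ℝ) with hn'
  set g : E → ℝ := fun x => ψ x * (‖V x‖ ^ 2 + 2 * α * P x
      - (n - 2 * α) * (⟪V x, x⟫ ^ 2 * (‖x‖ ^ 2)⁻¹)) with hg
  have hint : ∫ x, g x ∂μ = 0 := h.integral_cutoff_identity μ hψ hψc hψ0 hψr
  have hcont : Continuous g := by
    refine Shvydkoy2018.continuous_of_off_origin ?_ ?_
    · refine hψ.continuous.continuousOn.mul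
        ((((h.contDiffOn_velocity.continuousOn.norm).pow 2).add
          (continuousOn_const.mul h.contDiffOn_pressure.continuousOn)).sub
        (continuousOn_const.mul ((h.contDiffOn_normalPart.continuousOn.pow 2).mul ?_)))
      exact ((continuousOn_id.norm).pow 2).inv₀
        fun x hx => pow_ne_zero 2 (norm_ne_zero_iff.mpr hx)
    · filter_upwards [hψ0] with y hy
      simp [hg, hy]
  have hgnn : ∀ y, 0 ≤ ‖V y‖ ^ 2 + 2 * α * P y
      - (n - 2 * α) * (⟪V y, y⟫ ^ 2 * (‖y‖ ^ 2)⁻¹) ∨ ψ y = 0 := by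
    intro y
    rcases eq_or_ne y 0 with rfl | hy
    · exact Or.inr hψ0.eq_of_nhds
    left
    have hq0 : 0 ≤ ⟪V y, y⟫ ^ 2 * (‖y‖ ^ 2)⁻¹ := by positivity
    have hqle := inner_sq_mul_inv_norm_sq_le V hy
    have hPy := hP hy
    by_cases hcoef : 0 ≤ n - 2 * α
    · nlinarith [mul_nonneg hcoef hq0, mul_nonneg hcoef (sub_nonneg.mpr hqle),
        mul_nonneg hα.le hPy, sq_nonneg ‖V y‖]
    · nlinarith [mul_nonneg hα.le hPy, sq_nonneg ‖V y‖]
  have hnn : 0 ≤ g := fun y => by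
    rcases hgnn y with hy | hy
    · exact mul_nonneg (hψnn y) hy
    · simp [hg, hy]
  have hgc : HasCompactSupport g := hψc.mul_right
  have hae : g =ᵐ[μ] 0 :=
    (integral_eq_zero_iff_of_nonneg hnn (hcont.integrable_of_hasCompactSupport hgc)).mp hint
  have hzero : g = 0 := (Continuous.ae_eq_iff_eq μ hcont continuous_const).mp hae
  refine h.eq_zero_of_eq_zero_on_sphere (fun y hy => ?_) hx
  have hy0 : y ≠ 0 := by
    intro h0
    rw [h0, norm_zero] at hy
    norm_num at hy
  have hgy := congr_fun hzero y
  simp only [hg, Pi.zero_apply, hψ1 _ hy, one_mul] at hgy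
  have hq0 : 0 ≤ ⟪V y, y⟫ ^ 2 * (‖y‖ ^ 2)⁻¹ := by positivity
  have hqle := inner_sq_mul_inv_norm_sq_le V hy0
  have hPy := hP hy0
  have hV2 : ‖V y‖ ^ 2 = 0 := by
    by_cases hcoef : 0 ≤ n - 2 * α
    · nlinarith [mul_nonneg hcoef hq0, mul_nonneg hcoef (sub_nonneg.mpr hqle),
        mul_nonneg hα.le hPy, sq_nonneg ‖V y‖]
    · nlinarith [mul_nonneg hα.le hPy, sq_nonneg ‖V y‖]
  exact norm_eq_zero.mp (pow_eq_zero_iff two_ne_zero |>.mp hV2)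

end Rigidity

/-! ### Prop. 3.1 in the window: irrotational pairs are trivial -/

section Irrotational

variable (h : IsHomogeneousSteadyEuler α V P)
include h

/-- **Bernoulli's theorem for irrotational homogeneous stationary flows** (Shvydkoy (13):
`Ω × V = -½ ∇(|x|^{-2α} H)`, so `Ω = 0` makes the bulk Bernoulli function `‖V‖² + 2P = H/|x|^{2α}`
locally constant off the origin): if `DV(x)` is symmetric for every `x ≠ 0` (irrotationality,
dimension-free form), then `D(‖V‖² + 2P)(x) = 0` for `x ≠ 0`.  Bulk computation:
`D(‖V‖²+2P) w = 2⟪V, DV w⟫ + 2 DP w = 2⟪DV V, w⟫ + 2⟪∇P, w⟫ = 2⟪(V·∇)V + ∇P, w⟫ = 0`.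
[cite: Shvydkoy2018, §3 (13) and Prop. 3.1 ("Moreover, in this case `H = 0`")] -/
theorem fderiv_bernoulliFn_eq_zero_of_symmetric
    (hsym : ∀ ⦃x : E⦄, x ≠ 0 → ∀ u w : E, ⟪fderiv ℝ V x u, w⟫ = ⟪u, fderiv ℝ V x w⟫)
    ⦃x : E⦄ (hx : x ≠ 0) : fderiv ℝ (fun y => ‖V y‖ ^ 2 + 2 * P y) x = 0 := by
  rw [(Shvydkoy2018.hasFDerivAt_bernoulliFn (h.differentiableAt_velocity hx)
    (h.differentiableAt_pressure hx)).fderiv]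
  ext w
  simp only [add_apply, smul_apply, ContinuousLinearMap.comp_apply, innerSL_apply_apply,
    nsmul_eq_mul, smul_eq_mul, zero_apply]
  rw [← hsym hx (V x) w, h.inner_fderiv_velocity_velocity_eq hx]
  ring

/-- **Irrotational ⇒ `H = 0`** (the last clause of Shvydkoy's Prop. 3.1, for every `α ≠ 0`):
a homogeneous stationary Euler pair of degree `-α ≠ 0` with symmetric `DV` off the origin has
vanishing Bernoulli function, `‖V x‖² + 2 P x = 0` for `x ≠ 0` — its derivative vanishes
(`fderiv_bernoulliFn_eq_zero_of_symmetric`) while Euler's relation gives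
`x·∇(‖V‖²+2P) = -2α(‖V‖²+2P)` (`fderiv_bernoulliFn_apply_self`); no connectedness is needed.
[cite: Shvydkoy2018, §3 Prop. 3.1] -/
theorem bernoulliFn_eq_zero_of_symmetric (hα : α ≠ 0)
    (hsym : ∀ ⦃x : E⦄, x ≠ 0 → ∀ u w : E, ⟪fderiv ℝ V x u, w⟫ = ⟪u, fderiv ℝ V x w⟫)
    ⦃x : E⦄ (hx : x ≠ 0) : ‖V x‖ ^ 2 + 2 * P x = 0 := by
  have h1 := h.fderiv_bernoulliFn_apply_self hx
  rw [h.fderiv_bernoulliFn_eq_zero_of_symmetric hsym hx, zero_apply] at h1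
  have h2 : -(2 * α) ≠ 0 := by
    intro h0
    apply hα
    linarith
  exact (mul_eq_zero.mp h1.symm).resolve_left h2

/-- **Shvydkoy 2018, Prop. 3.1 in the window `1 < α < n-1` (bulk form, any dimension)**: an
irrotational (symmetric `DV` off the origin) `C¹` homogeneous stationary Euler pair of degree `-α`
with `1 < α < n-1` is trivial, `V ≡ 0` off the origin.  Printed: "Suppose `v, f, p ∈ C¹(S²)`,
and `Ω = 0`. Then `α ∈ ℤ ∖ {1}` …" — a window free of integers carries no irrotational solution.
Proof here: `H = 0` (`bernoulliFn_eq_zero_of_symmetric`) and Prop. 3.2 in the window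
(`eq_zero_of_bernoulli_eq_zero`), instead of the printed spectral argument.
[cite: Shvydkoy2018, §3 Prop. 3.1] -/
theorem eq_zero_of_symmetric (h1 : 1 < α) (h2 : α < (finrank ℝ E : ℝ) - 1)
    (hsym : ∀ ⦃x : E⦄, x ≠ 0 → ∀ u w : E, ⟪fderiv ℝ V x u, w⟫ = ⟪u, fderiv ℝ V x w⟫)
    ⦃x : E⦄ (hx : x ≠ 0) : V x = 0 :=
  h.eq_zero_of_bernoulli_eq_zero h1 h2
    (fun _ hy => h.bernoulliFn_eq_zero_of_symmetric (by linarith) hsym hy) hx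

end Irrotational

end IsHomogeneousSteadyEuler


/-! ### `ℝ³` statements in the window (the shape of the sibling facts) -/

/-- **Shvydkoy 2018, Prop. 3.2 in the window `1 < α < 2`** (Trans. AMS 370 (2018), §3 =
arXiv:1510.03378 p. 8: "For `α ≤ 2` irrotational solutions are unique in the class of all
`C²`-smooth solutions with `H = 0`", whose proof shows `f, v = 0` for `1 < α < 2`): a `C¹`
stationary Euler pair `(V, P)` on `ℝ³ ∖ {0}`, homogeneous of degrees `-α` (velocity) and `-2α`
(pressure) with `1 < α < 2`, whose Bernoulli function `H = |v|² + f² + 2p` vanishes — in bulk,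
`‖V x‖² + 2 P x = 0` for `x ≠ 0` — is trivial: `V ≡ 0` and `P ≡ 0` off the origin.
[cite: Shvydkoy2018, Prop. 3.2] -/
theorem shvydkoy2018_prop32_bernoulliZero_of_one_lt {α : ℝ} (h1 : 1 < α) (h2 : α < 2)
    {V : EuclideanSpace ℝ (Fin 3) → EuclideanSpace ℝ (Fin 3)} {P : EuclideanSpace ℝ (Fin 3) → ℝ}
    (hVP : IsHomogeneousSteadyEuler α V P)
    (hB : ∀ ⦃x : EuclideanSpace ℝ (Fin 3)⦄, x ≠ 0 → ‖V x‖ ^ 2 + 2 * P x = 0)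
    ⦃x : EuclideanSpace ℝ (Fin 3)⦄ (hx : x ≠ 0) : V x = 0 ∧ P x = 0 := by
  have hV : V x = 0 :=
    hVP.eq_zero_of_bernoulli_eq_zero h1 (by rw [finrank_euclideanSpace_fin]; norm_num; linarith)
      hB hx
  refine ⟨hV, ?_⟩
  have := hB hx
  rw [hV, norm_zero] at this
  linarith

/-- **Shvydkoy 2018, Cor. 4.4 in the window `α > 1`** (Trans. AMS 370 (2018), §4 =
arXiv:1510.03378 p. 9: "Suppose `p ≥ 0` and `α > 0`. Then the solution is trivial,
`v = f = p = 0`."): a `C¹` stationary Euler pair `(V, P)` on `ℝ³ ∖ {0}`, homogeneous of degrees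
`-α` and `-2α` with `α > 1`, whose pressure is non-negative off the origin (`P x ≥ 0` for
`x ≠ 0`, equivalently spherical pressure `p ≥ 0`) is trivial: `V ≡ 0` and `P ≡ 0` off the
origin.  The printed range is `α > 0`; only `α > 1` is proved here (`-- TODO(general form)`).
[cite: Shvydkoy2018, Cor. 4.4] -/
theorem shvydkoy2018_cor44_pressureNonneg_of_one_lt {α : ℝ} (h1 : 1 < α)
    {V : EuclideanSpace ℝ (Fin 3) → EuclideanSpace ℝ (Fin 3)} {P : EuclideanSpace ℝ (Fin 3) → ℝ}
    (hVP : IsHomogeneousSteadyEuler α V P)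
    (hP : ∀ ⦃x : EuclideanSpace ℝ (Fin 3)⦄, x ≠ 0 → 0 ≤ P x)
    ⦃x : EuclideanSpace ℝ (Fin 3)⦄ (hx : x ≠ 0) : V x = 0 ∧ P x = 0 := by
  have hV : ∀ ⦃y : EuclideanSpace ℝ (Fin 3)⦄, y ≠ 0 → V y = 0 := fun y hy =>
    hVP.eq_zero_of_pressure_nonneg (by linarith)
      (by rw [finrank_euclideanSpace_fin]; norm_num; linarith) hP hy
  exact ⟨hV hx, hVP.pressure_eq_zero_of_velocity_eq_zero (by linarith) hV hx⟩

/-- In `ℝ³`, `curl V x = 0` makes `DV(x)` symmetric (`‖curl V x‖² = ½|DV − DVᵀ|²_F`,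
the tree's `norm_curl_sq_eq_frobeniusNormSq_spin`; Majda–Bertozzi (1.22)–(1.24)). [folklore] -/
private theorem inner_fderiv_symm_of_curl_eq_zero
    {V : EuclideanSpace ℝ (Fin 3) → EuclideanSpace ℝ (Fin 3)} {x : EuclideanSpace ℝ (Fin 3)}
    (hV : DifferentiableAt ℝ V x) (hΩ : curl V x = 0) (u w : EuclideanSpace ℝ (Fin 3)) :
    ⟪fderiv ℝ V x u, w⟫ = ⟪u, fderiv ℝ V x w⟫ := by
  have hfrob : frobeniusNormSq (spin V x) = 0 := by
    have e := norm_curl_sq_eq_frobeniusNormSq_spin_holds V x hV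
    rw [hΩ, norm_zero] at e
    have : (0 : ℝ) ^ 2 = 0 := by norm_num
    rw [this] at e
    linarith
  have hspin : spin V x = 0 := by
    set b := stdOrthonormalBasis ℝ (EuclideanSpace ℝ (Fin 3))
    rw [frobeniusNormSq_eq_sum b] at hfrob
    have hterm : ∀ i, ‖spin V x (b i)‖ ^ 2 = 0 := fun i =>
      (Finset.sum_eq_zero_iff_of_nonneg fun j _ => sq_nonneg _).1 hfrob i (Finset.mem_univ i)
    have hbi : ∀ i, spin V x (b i) = 0 := fun i => by
      have := hterm i
      rwa [sq_eq_zero_iff, norm_eq_zero] at this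
    ext1 y
    rw [← b.sum_repr' y, map_sum, zero_apply]
    refine Finset.sum_eq_zero fun i _ => ?_
    rw [map_smul, hbi, smul_zero]
  have hadj : ContinuousLinearMap.adjoint (fderiv ℝ V x) = fderiv ℝ V x := by
    have e : fderiv ℝ V x - ContinuousLinearMap.adjoint (fderiv ℝ V x) = 0 := hspin
    exact (sub_eq_zero.1 e).symm
  rw [← ContinuousLinearMap.adjoint_inner_right, hadj]

/-- **Shvydkoy 2018, Prop. 3.1 in the window `1 < α < 2`** (Trans. AMS 370 (2018), §3 =
arXiv:1510.03378 p. 8: "Suppose `v, f, p ∈ C¹(S²)`, and `Ω = 0`. Then `α ∈ ℤ ∖ {1}` and the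
solution is given by (16) … Moreover, in this case `H = 0`."): a `C¹` stationary Euler pair
`(V, P)` on `ℝ³ ∖ {0}`, homogeneous of degrees `-α` (velocity) and `-2α` (pressure) with
`1 < α < 2` — a window containing no integer — which is IRROTATIONAL, `curl V x = 0` for
`x ≠ 0`, is trivial: `V ≡ 0` and `P ≡ 0` off the origin.  (Integer exponents and the explicit
harmonic solutions (16) of the printed statement are not vendored.)
[cite: Shvydkoy2018, §3 Prop. 3.1] -/
theorem shvydkoy2018_prop31_irrotational_of_one_lt {α : ℝ} (h1 : 1 < α) (h2 : α < 2)
    {V : EuclideanSpace ℝ (Fin 3) → EuclideanSpace ℝ (Fin 3)} {P : EuclideanSpace ℝ (Fin 3) → ℝ}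
    (hVP : IsHomogeneousSteadyEuler α V P)
    (hcurl : ∀ ⦃x : EuclideanSpace ℝ (Fin 3)⦄, x ≠ 0 → curl V x = 0)
    ⦃x : EuclideanSpace ℝ (Fin 3)⦄ (hx : x ≠ 0) : V x = 0 ∧ P x = 0 :=
  shvydkoy2018_prop32_bernoulliZero_of_one_lt h1 h2 hVP
    (fun y hy => hVP.bernoulliFn_eq_zero_of_symmetric (by linarith)
      (fun z hz u w => inner_fderiv_symm_of_curl_eq_zero (hVP.differentiableAt_velocity hz)
        (hcurl hz) u w) hy) hx

end Literature.Analysis.FluidPDE
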